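import Summits.CriticalPhenomena.PercolationContinuityZ3.Theorems.PercNearOneGluingNoHeavyLowerTailSahiCombTriWPartialFlip
import Summits.CriticalPhenomena.PercolationContinuityZ3.Theorems.PercNearOneGluingNoHeavyLowerTailSahiCombTriWProdCube
import Summits.CriticalPhenomena.PercolationContinuityZ3.Theorems.PercNearOneGluingNoHeavyLowerTailSahiCombTriWStrataTwo

/-!
# New strata of `TRI_W(a) ≥ 0` for every index cube: one SELF-DUAL family (`F` or `G`); the self-dual cylinder re-derived

Support file of the one-cut programme (crux `NoHeavyLowerTail`, stmt-CriticalPhenomena-4575; cell `prim-masterthm`, seat P5 gen 21).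

`…SahiCombTriWPartialFlip` proves the dipole inequality (`FiveUpSet.DipoleIneq`, pointwise) at every configuration `(X, Y, h, t)` in which
`X` or `Y` is a SELF-DUAL up-set (`sᶜ ∈ X ↔ s ∉ X`).  Here we push this through the product-cube embedding of `…SahiCombTriWProdCube`
(`X = prodSet F`, `Y = prodSet G`, `h = prodSet U`, `t = 1_β`), one configuration at a time:

* `FiveUpSet.triWGen_nonneg_of_dipole` — the plumbing of `triWGenIneq_of_dipoleIneq` for ONE triple of families;
* `FiveUpSet.selfDual_prodSet` — a self-dual FAMILY (`wᶜ ∈ V xᶜ ↔ w ∉ V x`) is a self-dual up-set of the product cube;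
* **`triWGen_nonneg_of_selfDual_mid` / `triWGen_nonneg_of_selfDual_right`** — `0 ≤ triWGen U F G` when `F`, resp. `G`, is a self-dual family;
* **`triW_nonneg_of_selfDual_right` / `triW_nonneg_of_selfDual_left`** — `0 ≤ triW P F G` for EVERY up-set `P`, every index cube `Finset β`,
  every cube `Finset γ`, all monotone families of up-sets, as soon as `G` (resp. `F`) is self-dual: new unconditional strata of `TriWIneq` defined by
  a condition on ONE family (the known strata constrain `P` — `refl P ⊆ P`, principal, self-dual cylinder — or both families — co-nested, bottom-empty, …);
(The self-dual CYLINDER stratum `uᶜ ∈ P ↔ u ∉ P` is lf-1's `triW_nonneg_of_selfDual` in `…SahiCombTriWSelfDual`; it also follows from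
`triWGen_nonneg_of_selfDual_mid` with the constant middle family, which is why it is not restated here.)
HONEST LABEL: unconditional theorems (std axioms); `TriWGenIneq` / `TriWIneq` remain OPEN in general. [this work]
-/

namespace Summit.CriticalPhenomena.PercolationContinuityZ3.Theorems

namespace FiveUpSet

open Finset
open scoped symmDiff

/-! ### The test set may be the self-dual one -/

section test

variable {α : Type} [DecidableEq α] [Fintype α]

/-- `refl` is an involution. [this work] -/
theorem refl_refl_eq (𝒜 : Finset (Finset α)) : refl (refl 𝒜) = 𝒜 := by
  ext s; simp [mem_refl]

/-- **The dipole inequality for a self-dual TEST set `h`.**  The rôles of `X` and `h` in the dipole configuration are exchanged by a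
global antipode (`t ↦ tᶜ`), so `dipoleIneq_of_selfDual_left` also covers self-dual `h`: together with `dipoleIneq_of_selfDual_left/right`,
the inequality holds as soon as ANY ONE of the three up-sets `X, Y, h` is self-dual. [this work] -/
theorem dipoleIneq_of_selfDual_test (X Y h : Finset (Finset α)) (t : Finset α)
    (hXu : IsUpperSet (X : Set (Finset α))) (hY : IsUpperSet (Y : Set (Finset α)))
    (hhu : IsUpperSet (h : Set (Finset α))) (hh : ∀ s : Finset α, sᶜ ∈ h ↔ s ∉ h) :
    (refl X ∩ Y ∩ h).card + (X ∩ refl Y ∩ h).card + (refl (X ∩ Y) ∩ h).card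
      ≤ 2 * (X ∩ Y ∩ h).card + (refl X ∩ transl t Y ∩ h).card := by
  have key := dipoleIneq_of_selfDual_left h Y X tᶜ hhu hh hY hXu
  have e1 : (refl h ∩ Y ∩ X).card = (refl (X ∩ Y) ∩ h).card := by
    rw [← card_refl (refl (X ∩ Y) ∩ h), refl_inter, refl_refl_eq]
    congr 1; ext s; simp only [mem_inter]; tauto
  have e2 : (h ∩ refl Y ∩ X).card = (X ∩ refl Y ∩ h).card := by
    congr 1; ext s; simp only [mem_inter]; tauto
  have e3 : (refl (h ∩ Y) ∩ X).card = (refl X ∩ Y ∩ h).card := by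
    rw [← card_refl (refl (h ∩ Y) ∩ X), refl_inter, refl_refl_eq]
    congr 1; ext s; simp only [mem_inter]; tauto
  have e4 : (h ∩ Y ∩ X).card = (X ∩ Y ∩ h).card := by
    congr 1; ext s; simp only [mem_inter]; tauto
  have e5 : (refl h ∩ transl tᶜ Y ∩ X).card = (refl X ∩ transl t Y ∩ h).card := by
    rw [← card_refl (refl h ∩ transl tᶜ Y ∩ X), refl_inter, refl_inter, refl_refl_eq, ← transl_univ, transl_transl]
    have et : univ ∆ tᶜ = t := by
      ext j; simp only [mem_symmDiff, mem_univ, mem_compl, true_and, not_not]; tauto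
    rw [et]
    congr 1; ext s; simp only [mem_inter]; tauto
  rw [e1, e2, e3, e4, e5] at key
  linarith

end test

/-! ### Product-cube plumbing: one configuration at a time -/

variable {β γ : Type} [DecidableEq β] [Fintype β] [DecidableEq γ] [Fintype γ]

/-- The dipole inequality at the product-cube configuration `(prodSet F, prodSet G, prodSet U, 1_β)` gives `0 ≤ triWGen U F G`
(the plumbing of `triWGenIneq_of_dipoleIneq`, for one triple of families). [this work] -/
theorem triWGen_nonneg_of_dipole (U F G : Finset β → Finset (Finset γ))
    (h : (refl (prodSet F) ∩ prodSet G ∩ prodSet U).card + (prodSet F ∩ refl (prodSet G) ∩ prodSet U).card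
        + (refl (prodSet F ∩ prodSet G) ∩ prodSet U).card
      ≤ 2 * (prodSet F ∩ prodSet G ∩ prodSet U).card + (refl (prodSet F) ∩ transl (betaFlip β γ) (prodSet G) ∩ prodSet U).card) :
    0 ≤ triWGen U F G := by
  classical
  have memT : ∀ u : Finset (β ⊕ γ), u ∈ transl (betaFlip β γ) (prodSet G) ↔ u.toRight ∈ G u.toLeftᶜ := by
    intro u
    rw [mem_transl, mem_prodSet, toRight_symmDiff', toLeft_symmDiff', betaFlip, Finset.toLeft_disjSum, Finset.toRight_disjSum,
      symmDiff_univ_eq_compl, symmDiff_empty_right]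
  have memR : ∀ (V : Finset β → Finset (Finset γ)) (u : Finset (β ⊕ γ)), u ∈ refl (prodSet V) ↔ u.toRightᶜ ∈ V u.toLeftᶜ := by
    intro V u; rw [mem_refl, mem_prodSet, LatticeFiveUpSet.toRight_compl, LatticeFiveUpSet.toLeft_compl]
  have c1 : ((prodSet F ∩ prodSet G ∩ prodSet U).card : ℤ) = ∑ x : Finset β, ((U x ∩ F x ∩ G x).card : ℤ) := by
    have e1 : prodSet F ∩ prodSet G ∩ prodSet U
        = univ.filter (fun u : Finset (β ⊕ γ) => u.toRight ∈ U u.toLeft ∧ u.toRight ∈ F u.toLeft ∧ u.toRight ∈ G u.toLeft) := by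
      ext u; simp only [mem_inter, mem_prodSet, mem_filter, mem_univ, true_and]; tauto
    rw [e1, card_filter_prod_eq_sum (fun x w => w ∈ U x ∧ w ∈ F x ∧ w ∈ G x)]
    refine sum_congr rfl fun x _ => ?_
    congr 2; ext w; simp
  have c2 : ((prodSet F ∩ refl (prodSet G) ∩ prodSet U).card : ℤ) = ∑ x : Finset β, ((U x ∩ F x ∩ refl (G xᶜ)).card : ℤ) := by
    have e1 : prodSet F ∩ refl (prodSet G) ∩ prodSet U
        = univ.filter (fun u : Finset (β ⊕ γ) => u.toRight ∈ U u.toLeft ∧ u.toRight ∈ F u.toLeft ∧ u.toRightᶜ ∈ G u.toLeftᶜ) := by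
      ext u; simp only [mem_inter, mem_prodSet, memR, mem_filter, mem_univ, true_and]; tauto
    rw [e1, card_filter_prod_eq_sum (fun x w => w ∈ U x ∧ w ∈ F x ∧ wᶜ ∈ G xᶜ)]
    refine sum_congr rfl fun x _ => ?_
    congr 2; ext w; simp [mem_refl]
  have c4 : ((refl (prodSet F) ∩ prodSet G ∩ prodSet U).card : ℤ) = ∑ x : Finset β, ((U x ∩ refl (F xᶜ) ∩ G x).card : ℤ) := by
    have e1 : refl (prodSet F) ∩ prodSet G ∩ prodSet U
        = univ.filter (fun u : Finset (β ⊕ γ) => u.toRight ∈ U u.toLeft ∧ u.toRightᶜ ∈ F u.toLeftᶜ ∧ u.toRight ∈ G u.toLeft) := by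
      ext u; simp only [mem_inter, mem_prodSet, memR, mem_filter, mem_univ, true_and]; tauto
    rw [e1, card_filter_prod_eq_sum (fun x w => w ∈ U x ∧ wᶜ ∈ F xᶜ ∧ w ∈ G x)]
    refine sum_congr rfl fun x _ => ?_
    congr 2; ext w; simp [mem_refl]
  have c5 : ((refl (prodSet F) ∩ transl (betaFlip β γ) (prodSet G) ∩ prodSet U).card : ℤ)
      = ∑ x : Finset β, ((U x ∩ refl (F xᶜ) ∩ G xᶜ).card : ℤ) := by
    have e1 : refl (prodSet F) ∩ transl (betaFlip β γ) (prodSet G) ∩ prodSet U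
        = univ.filter (fun u : Finset (β ⊕ γ) => u.toRight ∈ U u.toLeft ∧ u.toRightᶜ ∈ F u.toLeftᶜ ∧ u.toRight ∈ G u.toLeftᶜ) := by
      ext u; simp only [mem_inter, memR, memT, mem_prodSet, mem_filter, mem_univ, true_and]; tauto
    rw [e1, card_filter_prod_eq_sum (fun x w => w ∈ U x ∧ wᶜ ∈ F xᶜ ∧ w ∈ G xᶜ)]
    refine sum_congr rfl fun x _ => ?_
    congr 2; ext w; simp [mem_refl]
  have c3 : ((refl (prodSet F ∩ prodSet G) ∩ prodSet U).card : ℤ) = ∑ x : Finset β, ((refl (U xᶜ) ∩ F x ∩ G x).card : ℤ) := by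
    have e1 : refl (prodSet F ∩ prodSet G) ∩ prodSet U
        = univ.filter (fun u : Finset (β ⊕ γ) => u.toRight ∈ U u.toLeft ∧ u.toRightᶜ ∈ F u.toLeftᶜ ∧ u.toRightᶜ ∈ G u.toLeftᶜ) := by
      ext u; simp only [mem_inter, refl_inter, memR, mem_prodSet, mem_filter, mem_univ, true_and]; tauto
    rw [e1, card_filter_prod_eq_sum (fun x w => w ∈ U x ∧ wᶜ ∈ F xᶜ ∧ wᶜ ∈ G xᶜ)]
    have e2 : ∀ x : Finset β, ((univ.filter (fun w : Finset γ => w ∈ U x ∧ wᶜ ∈ F xᶜ ∧ wᶜ ∈ G xᶜ)).card : ℤ)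
        = ((refl (U xᶜᶜ) ∩ F xᶜ ∩ G xᶜ).card : ℤ) := by
      intro x
      rw [← card_refl (refl (U xᶜᶜ) ∩ F xᶜ ∩ G xᶜ)]
      congr 2; ext w
      simp [mem_refl, compl_compl]
    simp only [e2]
    exact Fintype.sum_equiv (complEquiv β) _ _ (fun x => by simp [complEquiv])
  have hZ : ((refl (prodSet F) ∩ prodSet G ∩ prodSet U).card : ℤ) + (prodSet F ∩ refl (prodSet G) ∩ prodSet U).card
      + (refl (prodSet F ∩ prodSet G) ∩ prodSet U).card
      ≤ 2 * ((prodSet F ∩ prodSet G ∩ prodSet U).card : ℤ) + (refl (prodSet F) ∩ transl (betaFlip β γ) (prodSet G) ∩ prodSet U).card := by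
    exact_mod_cast h
  rw [c1, c2, c3, c4, c5] at hZ
  unfold triWGen triWGenTerm
  simp only [sum_add_distrib, sum_sub_distrib, ← mul_sum]
  linarith

/-- A self-dual FAMILY (`wᶜ ∈ V xᶜ ↔ w ∉ V x`) is a self-dual up-set of the product cube. [this work] -/
theorem selfDual_prodSet {V : Finset β → Finset (Finset γ)} (hV : ∀ (x : Finset β) (w : Finset γ), wᶜ ∈ V xᶜ ↔ w ∉ V x) :
    ∀ u : Finset (β ⊕ γ), uᶜ ∈ prodSet V ↔ u ∉ prodSet V := by
  classical
  intro u
  rw [mem_prodSet, mem_prodSet, LatticeFiveUpSet.toRight_compl, LatticeFiveUpSet.toLeft_compl]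
  exact hV _ _

/-- **`triWGen U F G ≥ 0` whenever the middle family `F` is self-dual** (`wᶜ ∈ F xᶜ ↔ w ∉ F x`), for monotone families of up-sets `U, F, G`. [this work] -/
theorem triWGen_nonneg_of_selfDual_mid (U F G : Finset β → Finset (Finset γ))
    (hU : ∀ x, IsUpperSet (U x : Set (Finset γ))) (hF : ∀ x, IsUpperSet (F x : Set (Finset γ))) (hG : ∀ x, IsUpperSet (G x : Set (Finset γ)))
    (hUm : Monotone U) (hFm : Monotone F) (hGm : Monotone G)
    (hsd : ∀ (x : Finset β) (w : Finset γ), wᶜ ∈ F xᶜ ↔ w ∉ F x) :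
    0 ≤ triWGen U F G :=
  triWGen_nonneg_of_dipole U F G
    (dipoleIneq_of_selfDual_left (prodSet F) (prodSet G) (prodSet U) (betaFlip β γ)
      (isUpperSet_prodSet hF hFm) (selfDual_prodSet hsd) (isUpperSet_prodSet hG hGm) (isUpperSet_prodSet hU hUm))

/-- **`triWGen U F G ≥ 0` whenever the last family `G` is self-dual**, for monotone families of up-sets `U, F, G`. [this work] -/
theorem triWGen_nonneg_of_selfDual_right (U F G : Finset β → Finset (Finset γ))
    (hU : ∀ x, IsUpperSet (U x : Set (Finset γ))) (hF : ∀ x, IsUpperSet (F x : Set (Finset γ))) (hG : ∀ x, IsUpperSet (G x : Set (Finset γ)))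
    (hUm : Monotone U) (hFm : Monotone F) (hGm : Monotone G)
    (hsd : ∀ (x : Finset β) (w : Finset γ), wᶜ ∈ G xᶜ ↔ w ∉ G x) :
    0 ≤ triWGen U F G :=
  triWGen_nonneg_of_dipole U F G
    (dipoleIneq_of_selfDual_right (prodSet F) (prodSet G) (prodSet U) (betaFlip β γ)
      (isUpperSet_prodSet hF hFm) (isUpperSet_prodSet hG hGm) (selfDual_prodSet hsd) (isUpperSet_prodSet hU hUm))

/-! ### New strata of `TriWIneq`: one self-dual family -/

/-- **`TRI_W(a) ≥ 0` whenever `G` is a self-dual family** (`wᶜ ∈ G xᶜ ↔ w ∉ G x`): for EVERY up-set `P`, every index cube `Finset β`, every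
cube `Finset γ` and every monotone family of up-sets `F`.  A stratum of `TriWIneq` defined by a condition on one family alone. [this work] -/
theorem triW_nonneg_of_selfDual_right (P : Finset (Finset γ)) (F G : Finset β → Finset (Finset γ))
    (hP : IsUpperSet (P : Set (Finset γ))) (hF : ∀ x, IsUpperSet (F x : Set (Finset γ))) (hG : ∀ x, IsUpperSet (G x : Set (Finset γ)))
    (hFm : Monotone F) (hGm : Monotone G)
    (hsd : ∀ (x : Finset β) (w : Finset γ), wᶜ ∈ G xᶜ ↔ w ∉ G x) :
    0 ≤ triW P F G := by
  rw [← triWGen_const_eq_triW P F G]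
  exact triWGen_nonneg_of_selfDual_right F (fun _ => P) G hF (fun _ => hP) hG hFm (fun _ _ _ => le_rfl) hGm hsd

/-- **`TRI_W(a) ≥ 0` whenever `F` is a self-dual family**, by the `F ↔ G` symmetry `triW_symm`. [this work] -/
theorem triW_nonneg_of_selfDual_left (P : Finset (Finset γ)) (F G : Finset β → Finset (Finset γ))
    (hP : IsUpperSet (P : Set (Finset γ))) (hF : ∀ x, IsUpperSet (F x : Set (Finset γ))) (hG : ∀ x, IsUpperSet (G x : Set (Finset γ)))
    (hFm : Monotone F) (hGm : Monotone G)
    (hsd : ∀ (x : Finset β) (w : Finset γ), wᶜ ∈ F xᶜ ↔ w ∉ F x) :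
    0 ≤ triW P F G := by
  rw [triW_symm]
  exact triW_nonneg_of_selfDual_right P G F hP hG hF hGm hFm hsd

end FiveUpSet

end Summit.CriticalPhenomena.PercolationContinuityZ3.Theorems
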